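import Summits.ValiantsHypothesis.ValiantsHypothesis.Theorems.LacunarySymmetroidMatrixDescartesPivotRankOneCriticalWindowsThreeLoneLetter
import Summits.ValiantsHypothesis.ValiantsHypothesis.Theorems.LacunarySymmetroidMatrixDescartesPivotRankOneCriticalWindowsThree

/-!
# `MatrixDescartes` census — rank-one `(2,3)₁`: THE LONE-LETTER LAW, part 4 (the count: at most two critical directions per side,
# for every weight vector)

HONEST FRAMING.  Object-search cell `pub-symmetroid`, seat `val-sym-mdr-p1` (generation 22); helper file `--supports` the crux item
stmt-ValiantsHypothesis-18050 (`Theses.LacunarySymmetroid.MatrixDescartes`, OPEN, on HOLD) with NO closure claim.  Analytic packaging of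
`…CriticalWindowsThreeLoneLetter.logDeriv_fence` (one sign change of the logarithmic derivative `ℓ` per window) with the weight elimination of
`…CriticalWindowsThree` (`weights_prop_cross`, `cross_signs`, `window_of_critical_three`).  The `(2,3)₁` COUNT `Z₊ ≤ 5` is already kernel
(`…PivotRankOneThree`); the present statement is the PER-SIDE refinement the lineage located (memo PROFILE-GAUGE.md §5, «lone-letter law», K = 3):
with one upper letter on each side of the pivot letter, each side carries at most two critical directions of the three-letter window profile — for ALL
positive weights at once — i.e. at most one local maximum of the ψ-profile per side.  Nothing here bears on `MatrixDescartes` in its window, on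
`DoorA26` / `DoorA34`, registers / credences, or `VP ≠ VNP`; no `K ≥ 4` statement is claimed.

THE POINT (def-free; `X₀ = (T−tᵢ)(T−tⱼ)Q₀`, `Xᵢ = (T−tⱼ)(T−t₀)Qᵢ`, `Xⱼ = (T−t₀)(T−tᵢ)Qⱼ` spelled out as in `cross_factor`).
* §6 `hasDerivAt_weightFree` — the weight-free function `G(T) = (bᵢ−bⱼ)·log X₀ + (a+bⱼ)·log Xᵢ − (a+bᵢ)·log Xⱼ` has derivative `ℓ(T)` wherever the
  six factors are nonzero (`∑ cₖ = 0` removes the `1/(T−tₘ)` cross terms). [folklore]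
* §7 `weightFree_unimodal` — `G` is strictly increasing on `(Tₘ, T_R]` and strictly decreasing on `[T_R, tⱼ)` (right window), strictly decreasing on
  `(tᵢ, T_L]` and strictly increasing on `[T_L, r₊)` (left window); hence (`weightFree_level_atMostTwice_right/left`) every level is taken at most
  twice per window. [folklore]
* **§8 `lone_letter_three_right` / `lone_letter_three_left` (THE LONE-LETTER LAW, counting form).**  Fix positive rates with the pencil's coupling
  `(a+bⱼ)(dᵢ−d₀) = (a+bᵢ)(dⱼ−d₀)` (in the pencil `dᵢ − d₀ = a + bᵢ`, `dⱼ − d₀ = a + bⱼ`), positions `0 < tᵢ < t₀ < tⱼ` and ANY positive weights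
  `w₀, wᵢ, wⱼ`.  A critical point of the three-letter window profile is a pair `(x, T)`, `x > 0`, with `∑ Wₖ(T² − tₖ²) = 0` and
  `−aW₀(T−t₀)² + bᵢWᵢ(T−tᵢ)² + bⱼWⱼ(T−tⱼ)² = 0`, `Wₖ = wₖx^{dₖ}` (`…CriticalWindows`).  Then there are NO THREE critical points with directions
  `t₀ < T₁ < T₂ < T₃`, and no three with `0 < T₁ < T₂ < T₃ < t₀`: every critical direction beyond the pivot letter lies in the right window and
  satisfies `G(T) = κ(w) := (a+bⱼ)(log wᵢ − log w₀) − (a+bᵢ)(log wⱼ − log w₀)` (`weightFree_level_of_critical_right`), and `G` takes each level at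
  most twice there; mirror-wise on the left.
[folklore] Calculus (`HasDerivAt.log`, strict monotonicity from the sign of the derivative), logarithms, the companions' algebra.  No definitions,
no named facts.
-/

-- `Summit.ValiantsHypothesis.ValiantsHypothesis.…` repeats a component by the D-0017 layout
-- (single-conjunct summit), which the `dupNamespace` linter flags; the name is mandated.
set_option linter.dupNamespace false

open Polynomial

namespace Summit.ValiantsHypothesis.ValiantsHypothesis.Theorems.LacunarySymmetroidMatrixDescartes.Pivot.CriticalWindows.Three

/-! ## 6. The weight-free function and its derivative -/

/-- **DERIVATIVE OF THE WEIGHT-FREE FUNCTION.**  Wherever `Q₀, Qᵢ, Qⱼ, T−t₀, T−tᵢ, T−tⱼ` are nonzero,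
`d/dT [(bᵢ−bⱼ)log X₀ + (a+bⱼ)log Xᵢ − (a+bᵢ)log Xⱼ] = ℓ(T)` (the `1/(T−tₘ)` cross terms cancel because the three coefficients sum to zero;
`Real.log` is used on possibly negative arguments, which is harmless for derivatives). [folklore] -/
theorem hasDerivAt_weightFree {a bi bj t₀ ti tj T : ℝ} (h0 : (bj * (T + ti) * (T - tj) - bi * (T + tj) * (T - ti)) ≠ 0) (hi : (bj * (T + t₀) * (tj - T) - a * (T + tj) * (T - t₀)) ≠ 0) (hj : (bi * (T + t₀) * (T - ti) + a * (T + ti) * (T - t₀)) ≠ 0)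
    (l0 : T - t₀ ≠ 0) (li : T - ti ≠ 0) (lj : T - tj ≠ 0) :
    HasDerivAt (fun T : ℝ =>
        (bi - bj) * Real.log ((T - ti) * (T - tj) * (bj * (T + ti) * (T - tj) - bi * (T + tj) * (T - ti)))
        + (a + bj) * Real.log ((T - tj) * (T - t₀) * (bj * (T + t₀) * (tj - T) - a * (T + tj) * (T - t₀)))
        - (a + bi) * Real.log ((T - t₀) * (T - ti) * (bi * (T + t₀) * (T - ti) + a * (T + ti) * (T - t₀))))
      ((bi - bj) * ((bj * ((T - tj) + (T + ti)) - bi * ((T - ti) + (T + tj))) / (bj * (T + ti) * (T - tj) - bi * (T + tj) * (T - ti)) - 1 / (T - t₀))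
      + (a + bj) * ((bj * ((tj - T) - (T + t₀)) - a * ((T - t₀) + (T + tj))) / (bj * (T + t₀) * (tj - T) - a * (T + tj) * (T - t₀)) - 1 / (T - ti))
      - (a + bi) * ((bi * ((T - ti) + (T + t₀)) + a * ((T - t₀) + (T + ti))) / (bi * (T + t₀) * (T - ti) + a * (T + ti) * (T - t₀)) - 1 / (T - tj))) T := by
  -- derivatives of the three brackets
  have dQ0 : HasDerivAt (fun T : ℝ => (bj * (T + ti) * (T - tj) - bi * (T + tj) * (T - ti))) (bj * ((T - tj) + (T + ti)) - bi * ((T - ti) + (T + tj))) T :=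
    (((((hasDerivAt_id' T).add_const ti).const_mul bj).mul ((hasDerivAt_id' T).sub_const tj)).sub
      ((((hasDerivAt_id' T).add_const tj).const_mul bi).mul ((hasDerivAt_id' T).sub_const ti))).congr_deriv (by ring)
  have dQi : HasDerivAt (fun T : ℝ => (bj * (T + t₀) * (tj - T) - a * (T + tj) * (T - t₀))) (bj * ((tj - T) - (T + t₀)) - a * ((T - t₀) + (T + tj))) T :=
    (((((hasDerivAt_id' T).add_const t₀).const_mul bj).mul ((hasDerivAt_id' T).const_sub tj)).sub
      ((((hasDerivAt_id' T).add_const tj).const_mul a).mul ((hasDerivAt_id' T).sub_const t₀))).congr_deriv (by ring)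
  have dQj : HasDerivAt (fun T : ℝ => (bi * (T + t₀) * (T - ti) + a * (T + ti) * (T - t₀))) (bi * ((T - ti) + (T + t₀)) + a * ((T - t₀) + (T + ti))) T :=
    (((((hasDerivAt_id' T).add_const t₀).const_mul bi).mul ((hasDerivAt_id' T).sub_const ti)).add
      ((((hasDerivAt_id' T).add_const ti).const_mul a).mul ((hasDerivAt_id' T).sub_const t₀))).congr_deriv (by ring)
  -- the three quartics and their logarithms
  have dX0 := (((hasDerivAt_id' T).sub_const ti).mul ((hasDerivAt_id' T).sub_const tj)).mul dQ0
  have dXi := (((hasDerivAt_id' T).sub_const tj).mul ((hasDerivAt_id' T).sub_const t₀)).mul dQi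
  have dXj := (((hasDerivAt_id' T).sub_const t₀).mul ((hasDerivAt_id' T).sub_const ti)).mul dQj
  have nX0 : (T - ti) * (T - tj) * (bj * (T + ti) * (T - tj) - bi * (T + tj) * (T - ti)) ≠ 0 := mul_ne_zero (mul_ne_zero li lj) h0
  have nXi : (T - tj) * (T - t₀) * (bj * (T + t₀) * (tj - T) - a * (T + tj) * (T - t₀)) ≠ 0 := mul_ne_zero (mul_ne_zero lj l0) hi
  have nXj : (T - t₀) * (T - ti) * (bi * (T + t₀) * (T - ti) + a * (T + ti) * (T - t₀)) ≠ 0 := mul_ne_zero (mul_ne_zero l0 li) hj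
  have key := (((dX0.log nX0).const_mul (bi - bj)).add ((dXi.log nXi).const_mul (a + bj))).sub
    ((dXj.log nXj).const_mul (a + bi))
  have e0 : ((1 * (T - tj) + (T - ti) * 1) * (bj * (T + ti) * (T - tj) - bi * (T + tj) * (T - ti)) + (T - ti) * (T - tj) * (bj * ((T - tj) + (T + ti)) - bi * ((T - ti) + (T + tj))))
        / ((T - ti) * (T - tj) * (bj * (T + ti) * (T - tj) - bi * (T + tj) * (T - ti)))
      = (bj * ((T - tj) + (T + ti)) - bi * ((T - ti) + (T + tj))) / (bj * (T + ti) * (T - tj) - bi * (T + tj) * (T - ti)) + 1 / (T - ti) + 1 / (T - tj) := by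
    rw [div_add_div _ _ h0 li, div_add_div _ _ (mul_ne_zero h0 li) lj,
      div_eq_div_iff nX0 (mul_ne_zero (mul_ne_zero h0 li) lj)]
    ring
  have ei : ((1 * (T - t₀) + (T - tj) * 1) * (bj * (T + t₀) * (tj - T) - a * (T + tj) * (T - t₀)) + (T - tj) * (T - t₀) * (bj * ((tj - T) - (T + t₀)) - a * ((T - t₀) + (T + tj))))
        / ((T - tj) * (T - t₀) * (bj * (T + t₀) * (tj - T) - a * (T + tj) * (T - t₀)))
      = (bj * ((tj - T) - (T + t₀)) - a * ((T - t₀) + (T + tj))) / (bj * (T + t₀) * (tj - T) - a * (T + tj) * (T - t₀)) + 1 / (T - tj) + 1 / (T - t₀) := by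
    rw [div_add_div _ _ hi lj, div_add_div _ _ (mul_ne_zero hi lj) l0,
      div_eq_div_iff nXi (mul_ne_zero (mul_ne_zero hi lj) l0)]
    ring
  have ej : ((1 * (T - ti) + (T - t₀) * 1) * (bi * (T + t₀) * (T - ti) + a * (T + ti) * (T - t₀)) + (T - t₀) * (T - ti) * (bi * ((T - ti) + (T + t₀)) + a * ((T - t₀) + (T + ti))))
        / ((T - t₀) * (T - ti) * (bi * (T + t₀) * (T - ti) + a * (T + ti) * (T - t₀)))
      = (bi * ((T - ti) + (T + t₀)) + a * ((T - t₀) + (T + ti))) / (bi * (T + t₀) * (T - ti) + a * (T + ti) * (T - t₀)) + 1 / (T - t₀) + 1 / (T - ti) := by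
    rw [div_add_div _ _ hj l0, div_add_div _ _ (mul_ne_zero hj l0) li,
      div_eq_div_iff nXj (mul_ne_zero (mul_ne_zero hj l0) li)]
    ring
  refine key.congr_deriv ?_
  simp only [Pi.mul_apply]
  linear_combination (bi - bj) * e0 + (a + bj) * ei - (a + bi) * ej

/-! ## 7. Strict unimodality of the weight-free function on each window -/

/-- **THE WEIGHT-FREE FUNCTION IS STRICTLY UNIMODAL ON EACH WINDOW.**  With `Tₘ`, `r₊` the window edges (positive roots of `Qᵢ`, `Qⱼ`) there are
`T_R ∈ (Tₘ, tⱼ)` and `T_L ∈ (tᵢ, r₊)` such that `G = (bᵢ−bⱼ)log X₀ + (a+bⱼ)log Xᵢ − (a+bᵢ)log Xⱼ` is strictly increasing on `(Tₘ, T_R]`, strictly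
decreasing on `[T_R, tⱼ)`, strictly decreasing on `(tᵢ, T_L]`, strictly increasing on `[T_L, r₊)`; the window edges are characterised by the signs
of `Qᵢ`, `Qⱼ` on the positive axis. [folklore] -/
theorem weightFree_unimodal {a bi bj t₀ ti tj : ℝ} (ha : 0 < a) (hbi : 0 < bi) (hbj : 0 < bj) (hti : 0 < ti) (hi0 : ti < t₀)
    (h0j : t₀ < tj) :
    ∃ Tm rp TL TR : ℝ,
      (ti < TL ∧ TL < rp ∧ rp < t₀ ∧ t₀ < Tm ∧ Tm < TR ∧ TR < tj) ∧
      (bj * (Tm + t₀) * (tj - Tm) - a * (Tm + tj) * (Tm - t₀)) = 0 ∧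
      (bi * (rp + t₀) * (rp - ti) + a * (rp + ti) * (rp - t₀)) = 0 ∧
      (∀ T : ℝ, 0 < T → T < Tm → 0 < (bj * (T + t₀) * (tj - T) - a * (T + tj) * (T - t₀))) ∧
      (∀ T : ℝ, Tm < T → (bj * (T + t₀) * (tj - T) - a * (T + tj) * (T - t₀)) < 0) ∧
      (∀ T : ℝ, 0 < T → T < rp → (bi * (T + t₀) * (T - ti) + a * (T + ti) * (T - t₀)) < 0) ∧
      (∀ T : ℝ, rp < T → 0 < (bi * (T + t₀) * (T - ti) + a * (T + ti) * (T - t₀))) ∧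
      StrictMonoOn (fun T : ℝ =>
        (bi - bj) * Real.log ((T - ti) * (T - tj) * (bj * (T + ti) * (T - tj) - bi * (T + tj) * (T - ti)))
        + (a + bj) * Real.log ((T - tj) * (T - t₀) * (bj * (T + t₀) * (tj - T) - a * (T + tj) * (T - t₀)))
        - (a + bi) * Real.log ((T - t₀) * (T - ti) * (bi * (T + t₀) * (T - ti) + a * (T + ti) * (T - t₀)))) (Set.Ioc Tm TR) ∧
      StrictAntiOn (fun T : ℝ =>
        (bi - bj) * Real.log ((T - ti) * (T - tj) * (bj * (T + ti) * (T - tj) - bi * (T + tj) * (T - ti)))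
        + (a + bj) * Real.log ((T - tj) * (T - t₀) * (bj * (T + t₀) * (tj - T) - a * (T + tj) * (T - t₀)))
        - (a + bi) * Real.log ((T - t₀) * (T - ti) * (bi * (T + t₀) * (T - ti) + a * (T + ti) * (T - t₀)))) (Set.Ico TR tj) ∧
      StrictAntiOn (fun T : ℝ =>
        (bi - bj) * Real.log ((T - ti) * (T - tj) * (bj * (T + ti) * (T - tj) - bi * (T + tj) * (T - ti)))
        + (a + bj) * Real.log ((T - tj) * (T - t₀) * (bj * (T + t₀) * (tj - T) - a * (T + tj) * (T - t₀)))
        - (a + bi) * Real.log ((T - t₀) * (T - ti) * (bi * (T + t₀) * (T - ti) + a * (T + ti) * (T - t₀)))) (Set.Ioc ti TL) ∧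
      StrictMonoOn (fun T : ℝ =>
        (bi - bj) * Real.log ((T - ti) * (T - tj) * (bj * (T + ti) * (T - tj) - bi * (T + tj) * (T - ti)))
        + (a + bj) * Real.log ((T - tj) * (T - t₀) * (bj * (T + t₀) * (tj - T) - a * (T + tj) * (T - t₀)))
        - (a + bi) * Real.log ((T - t₀) * (T - ti) * (bi * (T + t₀) * (T - ti) + a * (T + ti) * (T - t₀)))) (Set.Ico TL rp) := by
  obtain ⟨Tm, rp, TL, TR, ⟨hL1, hL2, hrp2, hTm1, hR1, hR2⟩, hTm0, hrp0, qi_pos, qi_neg, qj_neg, qj_pos,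
    ellR_pos, -, ellR_neg, ellL_neg, -, ellL_pos⟩ := logDeriv_fence ha hbi hbj hti hi0 h0j
  obtain ⟨q0neg, -, qipos, -, -, -⟩ := bracket_signs ha hbi hbj hti hi0 h0j
  -- the derivative on the two windows
  have derivR : ∀ T : ℝ, Tm < T → T < tj → HasDerivAt (fun T : ℝ =>
        (bi - bj) * Real.log ((T - ti) * (T - tj) * (bj * (T + ti) * (T - tj) - bi * (T + tj) * (T - ti)))
        + (a + bj) * Real.log ((T - tj) * (T - t₀) * (bj * (T + t₀) * (tj - T) - a * (T + tj) * (T - t₀)))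
        - (a + bi) * Real.log ((T - t₀) * (T - ti) * (bi * (T + t₀) * (T - ti) + a * (T + ti) * (T - t₀))))
      ((bi - bj) * ((bj * ((T - tj) + (T + ti)) - bi * ((T - ti) + (T + tj))) / (bj * (T + ti) * (T - tj) - bi * (T + tj) * (T - ti)) - 1 / (T - t₀))
      + (a + bj) * ((bj * ((tj - T) - (T + t₀)) - a * ((T - t₀) + (T + tj))) / (bj * (T + t₀) * (tj - T) - a * (T + tj) * (T - t₀)) - 1 / (T - ti))
      - (a + bi) * ((bi * ((T - ti) + (T + t₀)) + a * ((T - t₀) + (T + ti))) / (bi * (T + t₀) * (T - ti) + a * (T + ti) * (T - t₀)) - 1 / (T - tj))) T := by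
    intro T h1 h2
    exact hasDerivAt_weightFree (ne_of_lt (q0neg T (by linarith) h2)) (ne_of_lt (qi_neg T h1))
      (ne_of_gt (qj_pos T (by linarith))) (ne_of_gt (by linarith)) (ne_of_gt (by linarith)) (ne_of_lt (by linarith))
  have derivL : ∀ T : ℝ, ti < T → T < rp → HasDerivAt (fun T : ℝ =>
        (bi - bj) * Real.log ((T - ti) * (T - tj) * (bj * (T + ti) * (T - tj) - bi * (T + tj) * (T - ti)))
        + (a + bj) * Real.log ((T - tj) * (T - t₀) * (bj * (T + t₀) * (tj - T) - a * (T + tj) * (T - t₀)))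
        - (a + bi) * Real.log ((T - t₀) * (T - ti) * (bi * (T + t₀) * (T - ti) + a * (T + ti) * (T - t₀))))
      ((bi - bj) * ((bj * ((T - tj) + (T + ti)) - bi * ((T - ti) + (T + tj))) / (bj * (T + ti) * (T - tj) - bi * (T + tj) * (T - ti)) - 1 / (T - t₀))
      + (a + bj) * ((bj * ((tj - T) - (T + t₀)) - a * ((T - t₀) + (T + tj))) / (bj * (T + t₀) * (tj - T) - a * (T + tj) * (T - t₀)) - 1 / (T - ti))
      - (a + bi) * ((bi * ((T - ti) + (T + t₀)) + a * ((T - t₀) + (T + ti))) / (bi * (T + t₀) * (T - ti) + a * (T + ti) * (T - t₀)) - 1 / (T - tj))) T := by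
    intro T h1 h2
    exact hasDerivAt_weightFree (ne_of_lt (q0neg T h1 (by linarith))) (ne_of_gt (qipos T (by linarith) (by linarith)))
      (ne_of_lt (qj_neg T (by linarith) h2)) (ne_of_lt (by linarith)) (ne_of_gt (by linarith)) (ne_of_lt (by linarith))
  refine ⟨Tm, rp, TL, TR, ⟨hL1, hL2, hrp2, hTm1, hR1, hR2⟩, hTm0, hrp0, qi_pos, qi_neg, qj_neg, qj_pos, ?_, ?_, ?_, ?_⟩
  · refine strictMonoOn_of_deriv_pos (convex_Ioc Tm TR) ?_ ?_
    · intro x hx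
      exact (derivR x hx.1 (by linarith [hx.2])).continuousAt.continuousWithinAt
    · intro x hx
      rw [interior_Ioc] at hx
      rw [(derivR x hx.1 (by linarith [hx.2])).deriv]
      exact ellR_pos x hx.1 hx.2
  · refine strictAntiOn_of_deriv_neg (convex_Ico TR tj) ?_ ?_
    · intro x hx
      exact (derivR x (by linarith [hx.1]) hx.2).continuousAt.continuousWithinAt
    · intro x hx
      rw [interior_Ico] at hx
      rw [(derivR x (by linarith [hx.1]) hx.2).deriv]
      exact ellR_neg x hx.1 hx.2
  · refine strictAntiOn_of_deriv_neg (convex_Ioc ti TL) ?_ ?_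
    · intro x hx
      exact (derivL x hx.1 (by linarith [hx.2])).continuousAt.continuousWithinAt
    · intro x hx
      rw [interior_Ioc] at hx
      rw [(derivL x hx.1 (by linarith [hx.2])).deriv]
      exact ellL_neg x hx.1 hx.2
  · refine strictMonoOn_of_deriv_pos (convex_Ico TL rp) ?_ ?_
    · intro x hx
      exact (derivL x (by linarith [hx.1]) hx.2).continuousAt.continuousWithinAt
    · intro x hx
      rw [interior_Ico] at hx
      rw [(derivL x (by linarith [hx.1]) hx.2).deriv]
      exact ellL_pos x hx.1 hx.2

/-- **EVERY LEVEL IS TAKEN AT MOST TWICE PER WINDOW.**  There are no three points `T₁ < T₂ < T₃` in the right window `{T > Tₘ : Qᵢ(T) < 0} ∩ (t₀,tⱼ)`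
— equivalently `t₀ < T₁`, `T₃ < tⱼ`, `Qᵢ(T₁) < 0` — at which the weight-free function takes the same value; and no three in the left window
(`tᵢ < T₁`, `T₃ < t₀`, `Qⱼ(T₃) < 0`). [folklore] -/
theorem weightFree_level_atMostTwice {a bi bj t₀ ti tj : ℝ} (ha : 0 < a) (hbi : 0 < bi) (hbj : 0 < bj) (hti : 0 < ti)
    (hi0 : ti < t₀) (h0j : t₀ < tj) (κ : ℝ) :
    (∀ T₁ T₂ T₃ : ℝ, t₀ < T₁ → T₁ < T₂ → T₂ < T₃ → T₃ < tj → (bj * (T₁ + t₀) * (tj - T₁) - a * (T₁ + tj) * (T₁ - t₀)) < 0 →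
      (bi - bj) * Real.log ((T₁ - ti) * (T₁ - tj) * (bj * (T₁ + ti) * (T₁ - tj) - bi * (T₁ + tj) * (T₁ - ti)))
        + (a + bj) * Real.log ((T₁ - tj) * (T₁ - t₀) * (bj * (T₁ + t₀) * (tj - T₁) - a * (T₁ + tj) * (T₁ - t₀)))
        - (a + bi) * Real.log ((T₁ - t₀) * (T₁ - ti) * (bi * (T₁ + t₀) * (T₁ - ti) + a * (T₁ + ti) * (T₁ - t₀))) = κ →
      (bi - bj) * Real.log ((T₂ - ti) * (T₂ - tj) * (bj * (T₂ + ti) * (T₂ - tj) - bi * (T₂ + tj) * (T₂ - ti)))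
        + (a + bj) * Real.log ((T₂ - tj) * (T₂ - t₀) * (bj * (T₂ + t₀) * (tj - T₂) - a * (T₂ + tj) * (T₂ - t₀)))
        - (a + bi) * Real.log ((T₂ - t₀) * (T₂ - ti) * (bi * (T₂ + t₀) * (T₂ - ti) + a * (T₂ + ti) * (T₂ - t₀))) = κ →
      (bi - bj) * Real.log ((T₃ - ti) * (T₃ - tj) * (bj * (T₃ + ti) * (T₃ - tj) - bi * (T₃ + tj) * (T₃ - ti)))
        + (a + bj) * Real.log ((T₃ - tj) * (T₃ - t₀) * (bj * (T₃ + t₀) * (tj - T₃) - a * (T₃ + tj) * (T₃ - t₀)))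
        - (a + bi) * Real.log ((T₃ - t₀) * (T₃ - ti) * (bi * (T₃ + t₀) * (T₃ - ti) + a * (T₃ + ti) * (T₃ - t₀))) = κ → False) ∧
    (∀ T₁ T₂ T₃ : ℝ, ti < T₁ → T₁ < T₂ → T₂ < T₃ → T₃ < t₀ → (bi * (T₃ + t₀) * (T₃ - ti) + a * (T₃ + ti) * (T₃ - t₀)) < 0 →
      (bi - bj) * Real.log ((T₁ - ti) * (T₁ - tj) * (bj * (T₁ + ti) * (T₁ - tj) - bi * (T₁ + tj) * (T₁ - ti)))
        + (a + bj) * Real.log ((T₁ - tj) * (T₁ - t₀) * (bj * (T₁ + t₀) * (tj - T₁) - a * (T₁ + tj) * (T₁ - t₀)))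
        - (a + bi) * Real.log ((T₁ - t₀) * (T₁ - ti) * (bi * (T₁ + t₀) * (T₁ - ti) + a * (T₁ + ti) * (T₁ - t₀))) = κ →
      (bi - bj) * Real.log ((T₂ - ti) * (T₂ - tj) * (bj * (T₂ + ti) * (T₂ - tj) - bi * (T₂ + tj) * (T₂ - ti)))
        + (a + bj) * Real.log ((T₂ - tj) * (T₂ - t₀) * (bj * (T₂ + t₀) * (tj - T₂) - a * (T₂ + tj) * (T₂ - t₀)))
        - (a + bi) * Real.log ((T₂ - t₀) * (T₂ - ti) * (bi * (T₂ + t₀) * (T₂ - ti) + a * (T₂ + ti) * (T₂ - t₀))) = κ →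
      (bi - bj) * Real.log ((T₃ - ti) * (T₃ - tj) * (bj * (T₃ + ti) * (T₃ - tj) - bi * (T₃ + tj) * (T₃ - ti)))
        + (a + bj) * Real.log ((T₃ - tj) * (T₃ - t₀) * (bj * (T₃ + t₀) * (tj - T₃) - a * (T₃ + tj) * (T₃ - t₀)))
        - (a + bi) * Real.log ((T₃ - t₀) * (T₃ - ti) * (bi * (T₃ + t₀) * (T₃ - ti) + a * (T₃ + ti) * (T₃ - t₀))) = κ → False) := by
  obtain ⟨Tm, rp, TL, TR, ⟨hL1, hL2, hrp2, hTm1, hR1, hR2⟩, hTm0, hrp0, qi_pos, qi_neg, qj_neg, qj_pos,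
    monoR, antiR, antiL, monoL⟩ := weightFree_unimodal ha hbi hbj hti hi0 h0j
  constructor
  · intro T₁ T₂ T₃ h01 h12 h23 h3j hQ e₁ e₂ e₃
    -- `T₁` lies beyond the window edge
    have hT₁ : Tm < T₁ := by
      by_contra h
      push Not at h
      rcases lt_or_eq_of_le h with h | h
      · exact absurd hQ (not_lt.mpr (qi_pos T₁ (by linarith) h).le)
      · rw [h, hTm0] at hQ
        exact lt_irrefl _ hQ
    rcases le_or_gt T₂ TR with h | h
    · have := monoR.injOn ⟨hT₁, le_of_lt (lt_of_lt_of_le h12 h)⟩ ⟨by linarith, h⟩ (e₁.trans e₂.symm)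
      linarith
    · have := antiR.injOn ⟨le_of_lt h, by linarith⟩ ⟨by linarith, h3j⟩ (e₂.trans e₃.symm)
      linarith
  · intro T₁ T₂ T₃ hi1 h12 h23 h30 hQ e₁ e₂ e₃
    have hT₃ : T₃ < rp := by
      by_contra h
      push Not at h
      rcases lt_or_eq_of_le h with h | h
      · exact absurd hQ (not_lt.mpr (qj_pos T₃ h).le)
      · rw [← h, hrp0] at hQ
        exact lt_irrefl _ hQ
    rcases le_or_gt T₂ TL with h | h
    · have := antiL.injOn ⟨hi1, le_of_lt (lt_of_lt_of_le h12 h)⟩ ⟨by linarith, h⟩ (e₁.trans e₂.symm)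
      linarith
    · have := monoL.injOn ⟨le_of_lt h, by linarith⟩ ⟨by linarith, by linarith⟩ (e₂.trans e₃.symm)
      linarith

/-! ## 8. The count: at most two critical directions per side, for every weight vector -/

/-- **A CRITICAL DIRECTION BEYOND THE PIVOT LETTER LIES IN THE RIGHT WINDOW AND ON THE LEVEL `κ(w)`.**  At a critical point `(x, T)` of the
three-letter window profile with `t₀ < T` (weights `Wₖ = wₖx^{dₖ}`, coupling `(a+bⱼ)(dᵢ−d₀) = (a+bᵢ)(dⱼ−d₀)`): `T < tⱼ`, `Qᵢ(T) < 0`, and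
`G(T) = (a+bⱼ)(log wᵢ − log w₀) − (a+bᵢ)(log wⱼ − log w₀)` — the weights only choose the level (logarithmic form of
`…CriticalWindowsThree.weightFree_critical_equation_three`). [folklore] -/
theorem weightFree_level_of_critical_right {a bi bj t₀ ti tj w₀ wi wj x T : ℝ} {d₀ di dj : ℕ}
    (ha : 0 < a) (hbi : 0 < bi) (hbj : 0 < bj) (hti : 0 < ti) (hi0 : ti < t₀) (h0j : t₀ < tj)
    (hw₀ : 0 < w₀) (hwi : 0 < wi) (hwj : 0 < wj) (hx : 0 < x) (h0T : t₀ < T)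
    (hcouple : (a + bj) * ((di : ℝ) - d₀) = (a + bi) * ((dj : ℝ) - d₀))
    (h1 : w₀ * x ^ d₀ * (T ^ 2 - t₀ ^ 2) + wi * x ^ di * (T ^ 2 - ti ^ 2) + wj * x ^ dj * (T ^ 2 - tj ^ 2) = 0)
    (h2 : w₀ * x ^ d₀ * (-a * (T - t₀) ^ 2) + wi * x ^ di * (bi * (T - ti) ^ 2) + wj * x ^ dj * (bj * (T - tj) ^ 2) = 0) :
    T < tj ∧ (bj * (T + t₀) * (tj - T) - a * (T + tj) * (T - t₀)) < 0 ∧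
      (bi - bj) * Real.log ((T - ti) * (T - tj) * (bj * (T + ti) * (T - tj) - bi * (T + tj) * (T - ti)))
        + (a + bj) * Real.log ((T - tj) * (T - t₀) * (bj * (T + t₀) * (tj - T) - a * (T + tj) * (T - t₀)))
        - (a + bi) * Real.log ((T - t₀) * (T - ti) * (bi * (T + t₀) * (T - ti) + a * (T + ti) * (T - t₀)))
      = (a + bj) * (Real.log wi - Real.log w₀) - (a + bi) * (Real.log wj - Real.log w₀) := by
  have hW₀ : 0 < w₀ * x ^ d₀ := mul_pos hw₀ (pow_pos hx _)
  have hWi : 0 < wi * x ^ di := mul_pos hwi (pow_pos hx _)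
  have hWj : 0 < wj * x ^ dj := mul_pos hwj (pow_pos hx _)
  obtain ⟨hTj, hwin⟩ := window_of_critical_three ha hbi hbj hW₀ hWi hWj hti (by linarith) hi0 h0T h1 h2
  have hQi : (bj * (T + t₀) * (tj - T) - a * (T + tj) * (T - t₀)) < 0 := by
    have e : a * (T - t₀) * (tj + T) = a * (T + tj) * (T - t₀) := by ring
    linarith
  obtain ⟨pri, prj⟩ := weights_prop_cross a bi bj t₀ ti tj T (w₀ * x ^ d₀) (wi * x ^ di) (wj * x ^ dj) h1 h2
  obtain ⟨hX0, hXj⟩ := cross_signs ha hbi hbj hti hi0 h0T hTj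
  have hXi : 0 < (T - tj) * (T - t₀) * (bj * (T + t₀) * (tj - T) - a * (T + tj) * (T - t₀)) := by
    have h := mul_pos hWi hX0
    rw [pri] at h
    exact pos_of_mul_pos_right h hW₀.le
  -- logarithms
  have li := congrArg Real.log pri
  have lj := congrArg Real.log prj
  rw [Real.log_mul (ne_of_gt hWi) (ne_of_gt hX0), Real.log_mul (ne_of_gt hW₀) (ne_of_gt hXi)] at li
  rw [Real.log_mul (ne_of_gt hWj) (ne_of_gt hX0), Real.log_mul (ne_of_gt hW₀) (ne_of_gt hXj)] at lj
  have lW₀ : Real.log (w₀ * x ^ d₀) = Real.log w₀ + (d₀ : ℝ) * Real.log x := by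
    rw [Real.log_mul (ne_of_gt hw₀) (ne_of_gt (pow_pos hx _)), Real.log_pow]
  have lWi : Real.log (wi * x ^ di) = Real.log wi + (di : ℝ) * Real.log x := by
    rw [Real.log_mul (ne_of_gt hwi) (ne_of_gt (pow_pos hx _)), Real.log_pow]
  have lWj : Real.log (wj * x ^ dj) = Real.log wj + (dj : ℝ) * Real.log x := by
    rw [Real.log_mul (ne_of_gt hwj) (ne_of_gt (pow_pos hx _)), Real.log_pow]
  refine ⟨hTj, hQi, ?_⟩
  linear_combination (-(a + bj)) * li + (a + bi) * lj + (a + bj) * lWi - (a + bi) * lWj + (bi - bj) * lW₀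
    + Real.log x * hcouple

/-- **… AND BELOW THE PIVOT LETTER: THE LEFT WINDOW AND THE SAME LEVEL.**  At a critical point `(x, T)` with `0 < T < t₀`: `tᵢ < T`, `Qⱼ(T) < 0`,
and `G(T) = κ(w)`. [folklore] -/
theorem weightFree_level_of_critical_left {a bi bj t₀ ti tj w₀ wi wj x T : ℝ} {d₀ di dj : ℕ}
    (ha : 0 < a) (hbi : 0 < bi) (hbj : 0 < bj) (hti : 0 < ti) (hi0 : ti < t₀) (h0j : t₀ < tj)
    (hw₀ : 0 < w₀) (hwi : 0 < wi) (hwj : 0 < wj) (hx : 0 < x) (hT : 0 < T) (hT0 : T < t₀)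
    (hcouple : (a + bj) * ((di : ℝ) - d₀) = (a + bi) * ((dj : ℝ) - d₀))
    (h1 : w₀ * x ^ d₀ * (T ^ 2 - t₀ ^ 2) + wi * x ^ di * (T ^ 2 - ti ^ 2) + wj * x ^ dj * (T ^ 2 - tj ^ 2) = 0)
    (h2 : w₀ * x ^ d₀ * (-a * (T - t₀) ^ 2) + wi * x ^ di * (bi * (T - ti) ^ 2) + wj * x ^ dj * (bj * (T - tj) ^ 2) = 0) :
    ti < T ∧ (bi * (T + t₀) * (T - ti) + a * (T + ti) * (T - t₀)) < 0 ∧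
      (bi - bj) * Real.log ((T - ti) * (T - tj) * (bj * (T + ti) * (T - tj) - bi * (T + tj) * (T - ti)))
        + (a + bj) * Real.log ((T - tj) * (T - t₀) * (bj * (T + t₀) * (tj - T) - a * (T + tj) * (T - t₀)))
        - (a + bi) * Real.log ((T - t₀) * (T - ti) * (bi * (T + t₀) * (T - ti) + a * (T + ti) * (T - t₀)))
      = (a + bj) * (Real.log wi - Real.log w₀) - (a + bi) * (Real.log wj - Real.log w₀) := by
  have hW₀ : 0 < w₀ * x ^ d₀ := mul_pos hw₀ (pow_pos hx _)
  have hWi : 0 < wi * x ^ di := mul_pos hwi (pow_pos hx _)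
  have hWj : 0 < wj * x ^ dj := mul_pos hwj (pow_pos hx _)
  -- the direction lies beyond letter `i`
  have hiT : ti < T := by
    by_contra h
    push Not at h
    have a0 : T ^ 2 - t₀ ^ 2 < 0 := by nlinarith
    have ai : T ^ 2 - ti ^ 2 ≤ 0 := by nlinarith
    have aj : T ^ 2 - tj ^ 2 < 0 := by nlinarith
    have := mul_neg_of_pos_of_neg hW₀ a0
    have := mul_nonpos_of_nonneg_of_nonpos hWi.le ai
    have := mul_neg_of_pos_of_neg hWj aj
    linarith
  obtain ⟨q0neg, -, qipos, -, -, -⟩ := bracket_signs ha hbi hbj hti hi0 h0j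
  have hX0 : 0 < (T - ti) * (T - tj) * (bj * (T + ti) * (T - tj) - bi * (T + tj) * (T - ti)) :=
    mul_pos_of_neg_of_neg (mul_neg_of_pos_of_neg (by linarith) (by linarith)) (q0neg T hiT (by linarith))
  obtain ⟨pri, prj⟩ := weights_prop_cross a bi bj t₀ ti tj T (w₀ * x ^ d₀) (wi * x ^ di) (wj * x ^ dj) h1 h2
  have hXi : 0 < (T - tj) * (T - t₀) * (bj * (T + t₀) * (tj - T) - a * (T + tj) * (T - t₀)) := by
    have h := mul_pos hWi hX0
    rw [pri] at h
    exact pos_of_mul_pos_right h hW₀.le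
  have hXj : 0 < (T - t₀) * (T - ti) * (bi * (T + t₀) * (T - ti) + a * (T + ti) * (T - t₀)) := by
    have h := mul_pos hWj hX0
    rw [prj] at h
    exact pos_of_mul_pos_right h hW₀.le
  have hQj : (bi * (T + t₀) * (T - ti) + a * (T + ti) * (T - t₀)) < 0 := by
    have hneg : (T - t₀) * (T - ti) < 0 := mul_neg_of_neg_of_pos (by linarith) (by linarith)
    rcases mul_pos_iff.mp hXj with ⟨h, -⟩ | ⟨-, h⟩
    · exact absurd h (not_lt.mpr hneg.le)
    · exact h
  have li := congrArg Real.log pri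
  have lj := congrArg Real.log prj
  rw [Real.log_mul (ne_of_gt hWi) (ne_of_gt hX0), Real.log_mul (ne_of_gt hW₀) (ne_of_gt hXi)] at li
  rw [Real.log_mul (ne_of_gt hWj) (ne_of_gt hX0), Real.log_mul (ne_of_gt hW₀) (ne_of_gt hXj)] at lj
  have lW₀ : Real.log (w₀ * x ^ d₀) = Real.log w₀ + (d₀ : ℝ) * Real.log x := by
    rw [Real.log_mul (ne_of_gt hw₀) (ne_of_gt (pow_pos hx _)), Real.log_pow]
  have lWi : Real.log (wi * x ^ di) = Real.log wi + (di : ℝ) * Real.log x := by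
    rw [Real.log_mul (ne_of_gt hwi) (ne_of_gt (pow_pos hx _)), Real.log_pow]
  have lWj : Real.log (wj * x ^ dj) = Real.log wj + (dj : ℝ) * Real.log x := by
    rw [Real.log_mul (ne_of_gt hwj) (ne_of_gt (pow_pos hx _)), Real.log_pow]
  refine ⟨hiT, hQj, ?_⟩
  linear_combination (-(a + bj)) * li + (a + bi) * lj + (a + bj) * lWi - (a + bi) * lWj + (bi - bj) * lW₀
    + Real.log x * hcouple

/-- **THE LONE-LETTER LAW, RIGHT SIDE: AT MOST TWO CRITICAL DIRECTIONS BEYOND THE PIVOT LETTER.**  Three letters (pivot at `t₀`, rate `−a`;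
`i` at `tᵢ < t₀`, rate `bᵢ`; `j` alone at `tⱼ > t₀`, rate `bⱼ`), exponents coupled as in the pencil (`(a+bⱼ)(dᵢ−d₀) = (a+bᵢ)(dⱼ−d₀)`), ANY positive
weights: there are no three critical points `(x₁,T₁), (x₂,T₂), (x₃,T₃)` of the window profile with `t₀ < T₁ < T₂ < T₃`.  Equivalently the ψ-profile
`M` has at most two critical points, hence at most ONE local maximum, on the lone letter's side (memo PROFILE-GAUGE.md §5: the located per-side law,
`K = 3`, now exact). [folklore] -/
theorem lone_letter_three_right {a bi bj t₀ ti tj w₀ wi wj : ℝ} {d₀ di dj : ℕ}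
    (ha : 0 < a) (hbi : 0 < bi) (hbj : 0 < bj) (hti : 0 < ti) (hi0 : ti < t₀) (h0j : t₀ < tj)
    (hw₀ : 0 < w₀) (hwi : 0 < wi) (hwj : 0 < wj)
    (hcouple : (a + bj) * ((di : ℝ) - d₀) = (a + bi) * ((dj : ℝ) - d₀))
    {x₁ x₂ x₃ T₁ T₂ T₃ : ℝ} (hx₁ : 0 < x₁) (hx₂ : 0 < x₂) (hx₃ : 0 < x₃)
    (h01 : t₀ < T₁) (h12 : T₁ < T₂) (h23 : T₂ < T₃)
    (c₁ : w₀ * x₁ ^ d₀ * (T₁ ^ 2 - t₀ ^ 2) + wi * x₁ ^ di * (T₁ ^ 2 - ti ^ 2) + wj * x₁ ^ dj * (T₁ ^ 2 - tj ^ 2) = 0)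
    (c₁' : w₀ * x₁ ^ d₀ * (-a * (T₁ - t₀) ^ 2) + wi * x₁ ^ di * (bi * (T₁ - ti) ^ 2) + wj * x₁ ^ dj * (bj * (T₁ - tj) ^ 2) = 0)
    (c₂ : w₀ * x₂ ^ d₀ * (T₂ ^ 2 - t₀ ^ 2) + wi * x₂ ^ di * (T₂ ^ 2 - ti ^ 2) + wj * x₂ ^ dj * (T₂ ^ 2 - tj ^ 2) = 0)
    (c₂' : w₀ * x₂ ^ d₀ * (-a * (T₂ - t₀) ^ 2) + wi * x₂ ^ di * (bi * (T₂ - ti) ^ 2) + wj * x₂ ^ dj * (bj * (T₂ - tj) ^ 2) = 0)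
    (c₃ : w₀ * x₃ ^ d₀ * (T₃ ^ 2 - t₀ ^ 2) + wi * x₃ ^ di * (T₃ ^ 2 - ti ^ 2) + wj * x₃ ^ dj * (T₃ ^ 2 - tj ^ 2) = 0)
    (c₃' : w₀ * x₃ ^ d₀ * (-a * (T₃ - t₀) ^ 2) + wi * x₃ ^ di * (bi * (T₃ - ti) ^ 2) + wj * x₃ ^ dj * (bj * (T₃ - tj) ^ 2) = 0) :
    False := by
  obtain ⟨-, hQ1, e₁⟩ := weightFree_level_of_critical_right ha hbi hbj hti hi0 h0j hw₀ hwi hwj hx₁ h01 hcouple c₁ c₁'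
  obtain ⟨-, -, e₂⟩ := weightFree_level_of_critical_right ha hbi hbj hti hi0 h0j hw₀ hwi hwj hx₂ (by linarith) hcouple c₂ c₂'
  obtain ⟨h3j, -, e₃⟩ := weightFree_level_of_critical_right ha hbi hbj hti hi0 h0j hw₀ hwi hwj hx₃ (by linarith) hcouple c₃ c₃'
  exact (weightFree_level_atMostTwice ha hbi hbj hti hi0 h0j _).1 T₁ T₂ T₃ h01 h12 h23 h3j hQ1 e₁ e₂ e₃

/-- **THE LONE-LETTER LAW, LEFT SIDE: AT MOST TWO CRITICAL DIRECTIONS BELOW THE PIVOT LETTER.**  Same setting; there are no three critical points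
with directions `0 < T₁ < T₂ < T₃ < t₀` (letter `i` alone on the left). [folklore] -/
theorem lone_letter_three_left {a bi bj t₀ ti tj w₀ wi wj : ℝ} {d₀ di dj : ℕ}
    (ha : 0 < a) (hbi : 0 < bi) (hbj : 0 < bj) (hti : 0 < ti) (hi0 : ti < t₀) (h0j : t₀ < tj)
    (hw₀ : 0 < w₀) (hwi : 0 < wi) (hwj : 0 < wj)
    (hcouple : (a + bj) * ((di : ℝ) - d₀) = (a + bi) * ((dj : ℝ) - d₀))
    {x₁ x₂ x₃ T₁ T₂ T₃ : ℝ} (hx₁ : 0 < x₁) (hx₂ : 0 < x₂) (hx₃ : 0 < x₃)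
    (hT₁ : 0 < T₁) (h12 : T₁ < T₂) (h23 : T₂ < T₃) (h30 : T₃ < t₀)
    (c₁ : w₀ * x₁ ^ d₀ * (T₁ ^ 2 - t₀ ^ 2) + wi * x₁ ^ di * (T₁ ^ 2 - ti ^ 2) + wj * x₁ ^ dj * (T₁ ^ 2 - tj ^ 2) = 0)
    (c₁' : w₀ * x₁ ^ d₀ * (-a * (T₁ - t₀) ^ 2) + wi * x₁ ^ di * (bi * (T₁ - ti) ^ 2) + wj * x₁ ^ dj * (bj * (T₁ - tj) ^ 2) = 0)
    (c₂ : w₀ * x₂ ^ d₀ * (T₂ ^ 2 - t₀ ^ 2) + wi * x₂ ^ di * (T₂ ^ 2 - ti ^ 2) + wj * x₂ ^ dj * (T₂ ^ 2 - tj ^ 2) = 0)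
    (c₂' : w₀ * x₂ ^ d₀ * (-a * (T₂ - t₀) ^ 2) + wi * x₂ ^ di * (bi * (T₂ - ti) ^ 2) + wj * x₂ ^ dj * (bj * (T₂ - tj) ^ 2) = 0)
    (c₃ : w₀ * x₃ ^ d₀ * (T₃ ^ 2 - t₀ ^ 2) + wi * x₃ ^ di * (T₃ ^ 2 - ti ^ 2) + wj * x₃ ^ dj * (T₃ ^ 2 - tj ^ 2) = 0)
    (c₃' : w₀ * x₃ ^ d₀ * (-a * (T₃ - t₀) ^ 2) + wi * x₃ ^ di * (bi * (T₃ - ti) ^ 2) + wj * x₃ ^ dj * (bj * (T₃ - tj) ^ 2) = 0) :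
    False := by
  obtain ⟨hi1, -, e₁⟩ := weightFree_level_of_critical_left ha hbi hbj hti hi0 h0j hw₀ hwi hwj hx₁ hT₁ (by linarith) hcouple c₁ c₁'
  obtain ⟨-, -, e₂⟩ := weightFree_level_of_critical_left ha hbi hbj hti hi0 h0j hw₀ hwi hwj hx₂ (by linarith) (by linarith)
    hcouple c₂ c₂'
  obtain ⟨-, hQ3, e₃⟩ := weightFree_level_of_critical_left ha hbi hbj hti hi0 h0j hw₀ hwi hwj hx₃ (by linarith) h30 hcouple c₃ c₃'
  exact (weightFree_level_atMostTwice ha hbi hbj hti hi0 h0j _).2 T₁ T₂ T₃ hi1 h12 h23 h30 hQ3 e₁ e₂ e₃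

end Summit.ValiantsHypothesis.ValiantsHypothesis.Theorems.LacunarySymmetroidMatrixDescartes.Pivot.CriticalWindows.Three
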